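import Summits.BirchSwinnertonDyer.Rank1Residual.Additive.GordEvenCongruentPartnerBSDControl
import Summits.BirchSwinnertonDyer.Rank1Residual.Additive.LocalTowerKernelAtPTwistedOrdinaryClasses
import HarnessLib

/-!
# The e346 END-of-ENDs `T-E346-TP`, §C′: the control-partner form with the `v ∣ p` input DISCHARGED
# by row T-T3B (p12 GEN 8's F6 `ClassX4Gord.localTowerKerPrimary_zero_eq_bot_of_five_le_of_semistabilityIndex_ne_two`,
# itself F5 ∘ p07's F4 ∘ F6a) — the 499800el1 ↔ 9800bn1 road with NO level-0 kernel binder left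
# (cell `b2b-bsdres`, team n1011, seat p07 (gen 9) — row T-E346-TP §C′; consumes §C p304380 and
# T-T3B F6 BY NAME)

HONEST FRAMING (cell `b2b-bsdres`, run/shared/lean/b2b/bsd-rank1-residual/, verbatim in every
file): the goal of the cell is to DELETE the COMBINATION-SHAPED residual classes of the
Birch–Swinnerton-Dyer formula for ALL analytic-rank `≤ 1` elliptic curves over `ℚ` — "full BSD
formula for every rank `≤ 1` curve in class `C`" assembled STRICTLY from published theorems — so
that the rank-`≤ 1` remainder becomes exactly the CONSTRUCTION-SHAPED classes, which are TYPED
(missing-input `Prop`s), NOT attempted. This is not "finishing BSD". Team n1011 (N10/N11, the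
X4♯(G-ord) e346 receivers): research route; labels and marks UNCHANGED; nothing booked; census /
instrument output = EVIDENCE, never a Literature fact. ASSEMBLY theorems only: NO definition, NO
named fact, NO new named-fact debt (`hDelA` STANDING on the receiver side, flag
`Del02-ThmB-ellp-anomalous`; partner side Delbourgo-free). CONDITIONAL exactly as the consumed files.

## What

§C (`ClassX4Gord.bsdp_rankZero_e346_of_controlPartner_of_shaAn_unit`) took the partner's level-`0`
local tower kernel above `p` as the binder `hp0₁ : ∀ κ, ∀ v ∈ S₁, v ∋ p → 𝒦_{v,0}[p^∞] = ⊥`. Row T-T3B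
proves it for every X4♯(G-ord) curve with `e ≠ 2` at `p ≥ 5` (Greenberg's Lemma 3.4 shape with both
anomalous factors killed by the ramified quotient character: p12's F1/F2/F3/F5/F6a/F6 with p07's F4
`GoodModelKernelRationalPoints` and engine `AdditiveFixedPoints*`). Hence:

* `ClassX4Gord.bsdp_rankZero_e346_of_controlPartnerT3B_of_shaAn_unit` — §C with `hp0₁` DISCHARGED
  (`he2₁ : e(W₁) ≠ 2` is already a partner column); partner binders left: `hSel₁`
  (`#Sel_{p^∞}(E₁/ℚ) = 1`, census), `S₁` / `hadd₁` / `hgood₁` (the partner's bad places away from `p`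
  are additive; census), besides the class columns.
* `ClassX4Gord.bsdp_rankZero_five_four_of_controlPartnerT3B_of_shaAn_unit` — (5;4,4) numerals
  (499800el1 ↔ 9800bn1 @ 5: bad places `2, 7` of 9800bn1 additive).

WHAT IS NEW: nothing mathematically — composition; closes nothing; census −0; nothing booked.

References: R. Greenberg, LNM 1716 (1999) §3 Lemma 3.4, Prop. 3.8 [GreenbergLNM1716]; the files
consumed; cells/n1011/ROUTE-2.md §II.28.3 (c1), II.30.4; cells/n1011/skel/T-T3B.md, T-T3CTL.md.
-/

set_option autoImplicit false

noncomputable section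

open scoped Classical MatrixGroups ModularForm NumberField

open CongruenceSubgroup WeierstrassCurve NumberField IsDedekindDomain Field
  Literature.NumberTheory.EllipticCurves
  Literature.NumberTheory.EllipticCurves.ModularForms
  Literature.NumberTheory.EllipticCurves.Rank1Residual
  Literature.NumberTheory.EllipticCurves.Rank1Residual.Typed
  Literature.NumberTheory.EllipticCurves.Delbourgo2002
  Literature.NumberTheory.EllipticCurves.Greenberg1999
  Literature.NumberTheory.EllipticCurves.GreenbergVatsal2000
  Literature.NumberTheory.EllipticCurves.CoatesGreenberg1996

namespace Summit.BirchSwinnertonDyer.Rank1Residual.Additive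

open Summit.BirchSwinnertonDyer.Rank1Residual.X1.CongruenceTransfer

variable {p : ℕ} [hp : Fact p.Prime] {W₁ W : WeierstrassCurve ℚ} [W₁.IsElliptic] [W₁.IsGloballyMinimal]
  [W.IsElliptic] [W.IsGloballyMinimal]

/-! ### §C′ The control partner with the `v ∣ p` kernel discharged by T-T3B -/

/-- **T-E346-TP, CONTROL-partner form, `v ∣ p` input discharged (T-T3B).** §C with
`hp0₁ := fun κ v _ hv ↦ ClassX4Gord.localTowerKerPrimary_zero_eq_bot_of_five_le_of_semistabilityIndex_ne_two
hX₁ hp5 he2₁ hv κ`. Partner side: trivial `p^∞`-Selmer group + all bad places away from `p` additive;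
no Delbourgo, no non-anomaly, no level-`0` kernel binder. Closes nothing by itself; nothing booked.
[cite: GreenbergLNM1716, §3 Lemma 3.4 (p. 89) and Prop. 3.8 (pp. 95–96)]
[cite: Delbourgo2002, Theorem (A), (C) (p. 40)] [cite: Delbourgo1998, Prop. 4 (p. 144)]
[cite: GreenbergVatsal2000, §2 Prop. (2.8) with Remark (2.9), Cor. (2.3), pp. 26–27 (arXiv:math/9906215)] -/
theorem ClassX4Gord.bsdp_rankZero_e346_of_controlPartnerT3B_of_shaAn_unit
    (hC : Delbourgo2002.thmC_charIdeal_dvd_tameBranch)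
    (hDelA : Delbourgo2002.mainTheorem) (hDelM : Delbourgo2002.mainTheorem_potMult)
    (hDel : Delbourgo1998.prop4_rankZero_pow_dvd_constantCoeff)
    (hGZK : rank_eq_analyticRank_of_analyticRank_le_one) (hmod : hasEntireLFunction_rat)
    (hGV : muLambdaAlg_transfer_of_torsionIso_potOrd_of_not_dvd_torsionOrder)
    (hCG : H1_goodModelKernel_trivial.{0})
    -- receiver columns
    (hX : ClassX4Gord W p) (hp5 : 5 ≤ p) (hcm : ¬ W.HasCM) (hr : W.analyticRank = 0)
    (he : semistabilityIndex W p ∈ ({3, 4, 6} : Finset ℕ))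
    (h2e : 2 ∣ semistabilityIndex W p) (hodd : ¬ 2 ∣ (p - 1) / semistabilityIndex W p)
    -- partner columns + link
    (hX₁ : ClassX4Gord W₁ p) (hcm₁ : ¬ W₁.HasCM)
    (h2e₁ : 2 ∣ semistabilityIndex W₁ p) (he2₁ : semistabilityIndex W₁ p ≠ 2)
    (hodd₁ : ¬ 2 ∣ (p - 1) / semistabilityIndex W₁ p)
    (hT : TorsionIso W₁ W p)
    -- partner control data (T-T3CTL): trivial Selmer, additive away from p
    (hSel₁ : Nat.card (W₁.selmerGroupPInfty p) = 1)
    (S₁ : Finset (HeightOneSpectrum (𝓞 ℚ)))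
    (hadd₁ : ∀ v ∈ S₁, ((p : ℕ) : 𝓞 ℚ) ∉ v.asIdeal → W₁.HasAdditiveReductionAt v)
    (hgood₁ : ∀ v ∉ S₁, ((p : ℕ) : 𝓞 ℚ) ∉ v.asIdeal ∧ W₁.HasGoodReductionAt v)
    -- census tuple (EVIDENCE tier)
    (h : CensusX43.OrdinaryTwistPartnerAt W p)
    {N : ℕ} [NeZero N] {f : CuspForm (Gamma0 N) 2} (hf : IsNewformOf W f)
    {χ : MulChar (ZMod p) ℚ_[p]}
    (hχ : CensusX43.IsTeichmullerPow χ (CensusX43.ordinaryTeichmullerExponent W p))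
    -- period binder, #Ш_an
    {q : ℚ} (hq : W.entireLFunction 1 = (q : ℂ) * (W.realPeriodRat : ℂ))
    {u : ℤ_[p]ˣ} (hu : ((ratPlusSymbol f 0 : ℚ) : ℚ_[p]) = ((u : ℤ_[p]) : ℚ_[p]) * (q : ℚ_[p]))
    {s : ℚ} (hs : shaAn W = (s : ℂ)) (hv : padicValRat p s = 0) : BSDp W p :=
  hX.bsdp_rankZero_e346_of_controlPartner_of_shaAn_unit hC hDelA hDelM hDel hGZK hmod hGV hCG hp5 hcm hr
    he h2e hodd hX₁ hcm₁ h2e₁ he2₁ hodd₁ hT hSel₁ S₁ hadd₁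
    (fun κ _ _ hpv ↦ GoodModelLine.ClassX4Gord.localTowerKerPrimary_zero_eq_bot_of_five_le_of_semistabilityIndex_ne_two
      hX₁ hp5 he2₁ hpv κ)
    hgood₁ h hf hχ hq hu hs hv

/-- **T-E346-TP at `(5;4,4)`, CONTROL-partner form, `v ∣ p` input discharged** — the row of record
499800el1 ↔ 9800bn1 @ 5: numerals. Closes nothing by itself; nothing booked.
[cite: GreenbergLNM1716, §3 Lemma 3.4 (p. 89) and Prop. 3.8 (pp. 95–96)]
[cite: Delbourgo2002, Theorem (A), (C) (p. 40)] [cite: Delbourgo1998, Prop. 4 (p. 144)]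
[cite: GreenbergVatsal2000, §2 Prop. (2.8) with Remark (2.9), Cor. (2.3), pp. 26–27 (arXiv:math/9906215)] -/
theorem ClassX4Gord.bsdp_rankZero_five_four_of_controlPartnerT3B_of_shaAn_unit (hp5 : p = 5)
    (hC : Delbourgo2002.thmC_charIdeal_dvd_tameBranch)
    (hDelA : Delbourgo2002.mainTheorem) (hDelM : Delbourgo2002.mainTheorem_potMult)
    (hDel : Delbourgo1998.prop4_rankZero_pow_dvd_constantCoeff)
    (hGZK : rank_eq_analyticRank_of_analyticRank_le_one) (hmod : hasEntireLFunction_rat)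
    (hGV : muLambdaAlg_transfer_of_torsionIso_potOrd_of_not_dvd_torsionOrder)
    (hCG : H1_goodModelKernel_trivial.{0})
    (hX : ClassX4Gord W p) (hcm : ¬ W.HasCM) (hr : W.analyticRank = 0)
    (he : semistabilityIndex W p = 4)
    (hX₁ : ClassX4Gord W₁ p) (hcm₁ : ¬ W₁.HasCM) (he₁ : semistabilityIndex W₁ p = 4)
    (hT : TorsionIso W₁ W p)
    (hSel₁ : Nat.card (W₁.selmerGroupPInfty p) = 1)
    (S₁ : Finset (HeightOneSpectrum (𝓞 ℚ)))
    (hadd₁ : ∀ v ∈ S₁, ((p : ℕ) : 𝓞 ℚ) ∉ v.asIdeal → W₁.HasAdditiveReductionAt v)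
    (hgood₁ : ∀ v ∉ S₁, ((p : ℕ) : 𝓞 ℚ) ∉ v.asIdeal ∧ W₁.HasGoodReductionAt v)
    (h : CensusX43.OrdinaryTwistPartnerAt W p)
    {N : ℕ} [NeZero N] {f : CuspForm (Gamma0 N) 2} (hf : IsNewformOf W f)
    {χ : MulChar (ZMod p) ℚ_[p]}
    (hχ : CensusX43.IsTeichmullerPow χ (CensusX43.ordinaryTeichmullerExponent W p))
    {q : ℚ} (hq : W.entireLFunction 1 = (q : ℂ) * (W.realPeriodRat : ℂ))
    {u : ℤ_[p]ˣ} (hu : ((ratPlusSymbol f 0 : ℚ) : ℚ_[p]) = ((u : ℤ_[p]) : ℚ_[p]) * (q : ℚ_[p]))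
    {s : ℚ} (hs : shaAn W = (s : ℂ)) (hv : padicValRat p s = 0) : BSDp W p := by
  subst hp5
  exact hX.bsdp_rankZero_e346_of_controlPartnerT3B_of_shaAn_unit hC hDelA hDelM hDel hGZK hmod hGV hCG
    le_rfl hcm hr (by rw [he]; decide) (by rw [he]; decide) (by rw [he]; decide) hX₁ hcm₁
    (by rw [he₁]; decide) (by rw [he₁]; decide) (by rw [he₁]; decide) hT hSel₁ S₁ hadd₁ hgood₁ h hf hχ hq
    hu hs hv

end Summit.BirchSwinnertonDyer.Rank1Residual.Additive

end
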